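import Literature.Barriers.AtomisticToContinuum.NoBVEstimatesMultiDEnergyIdentity
import Literature.Analysis.PDE.CoordWordTameWhole
import Literature.Analysis.PDE.SupBound
import HarnessLib

/-!
# Word derivatives of the quasilinear field `G(w) = Σⱼ aⱼ(w)∂ⱼw + b(w)`: the top/lower-order
# splitting and its `L²` bounds from sup and `L²` controls of `w`

Brick B-δ, §4a (static layer), of the Kato existence programme for the symmetrizable branch of
Rauch's Local Existence Theorem (towards `Rauch1986_smallAmplitudeExpansionL2`). For a smooth
field `w : ℝᵈ → ℝᵏ` and smooth symmetrizable tame coefficients (`IsSymmSmoothCoeff`), the word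
derivative `∂_α G(w)` of the first-order field splits, by the Leibniz expansion over splittings
(`cwd_bilinear`), into the TOP-ORDER part `Σⱼ aⱼ(w) ∂ⱼ∂_α w` (handled later by the symmetry of
`s aⱼ` and one integration by parts) and a LOWER-ORDER part all of whose terms carry at most `|α|`
derivatives of `w` and at least one derivative on a coefficient [Majda1984, Ch. 2, (2.13)–(2.14)],
[TaylorPDEIII2011, Ch. 16, §1, (1.12)–(1.13)]. This file proves, for a FIXED `w`:

* `cwd_gfield_eq`, `cwd_gfield_split` — the Leibniz expansion and the top/lower splitting;
* `norm_gfield_le` — the sup bound `‖G(w)‖ ≤ (dM + L) R₀`;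
* `memLp_top_term`, `memLp_low_term`, `memLp_b_term`, `memLp_low_part`, `memLp_cwd_gfield` —
  `L²` membership and bounds of every piece, LINEAR in the `L²` control `Yₛ` of the word
  derivatives of `w` (the top part costs the extra factor `D`, which along the regularised flow is
  `O(δ⁻¹)`; the lower part does not), from: sup control of `∂_c w` (`|c| ≤ q`), `L²` control of
  `∂_c w` (`|c| ≤ m`) and of `∂ⱼ∂_c w` (`|c| ≤ m`, constant `D Yₛ`), and the whole-space tame
  bounds of `CoordWordTameWhole.lean` for `aⱼ ∘ w`, `b ∘ w` (taken as hypotheses `hTa, hSa, hTb`),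
  under `m ≤ 2q`;
* `contDiff_sa_comp`, `inner_sa_comp_comm`, `norm_sa_comp_le`, `norm_fderiv_sa_comp_le` — the
  symmetric operator field `Pⱼ = s(w) aⱼ(w)` of the top-order term and its `C¹` bounds.

Everything is proved; no named fact and no `sorry` is introduced.

## References

* [Majda1984] A. Majda, *Compressible Fluid Flow and Systems of Conservation Laws in Several
  Space Variables* (1984), Ch. 2, §2.1, (2.13)–(2.14).
* [TaylorPDEIII2011] M. E. Taylor, *Partial Differential Equations III*, 2nd ed. (2011), Ch. 16,
  §1, (1.12)–(1.13); Ch. 13, §3, Prop. 3.7.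
-/

noncomputable section

open MeasureTheory Set Function Filter Metric ContinuousLinearMap
open scoped ContDiff Topology ENNReal NNReal RealInnerProductSpace

namespace Literature.Barriers.AtomisticToContinuum

open Literature.Analysis.PDE Literature.Analysis.FunctionSpaces

variable {d k : ℕ}

section Static

variable {M L : ℝ} {a : Fin d → (EuclideanSpace ℝ (Fin k)) → ((EuclideanSpace ℝ (Fin k)) →L[ℝ] (EuclideanSpace ℝ (Fin k)))} {b : (EuclideanSpace ℝ (Fin k)) → (EuclideanSpace ℝ (Fin k))}
  {s : (EuclideanSpace ℝ (Fin k)) → ((EuclideanSpace ℝ (Fin k)) →L[ℝ] (EuclideanSpace ℝ (Fin k)))} {w : (EuclideanSpace ℝ (Fin d)) → (EuclideanSpace ℝ (Fin k))}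

/-! ### Smoothness of the compositions and the Leibniz expansion of `∂_α G(w)` -/

/-- `aⱼ ∘ w` is smooth. [folklore] -/
theorem contDiff_a_comp (hS : IsSymmSmoothCoeff M L a b s) (hw : ContDiff ℝ ∞ w) (j : Fin d) :
    ContDiff ℝ ∞ fun x => a j (w x) :=
  (hS.smooth_a j).comp hw

/-- `b ∘ w` is smooth. [folklore] -/
theorem contDiff_b_comp (hS : IsSymmSmoothCoeff M L a b s) (hw : ContDiff ℝ ∞ w) :
    ContDiff ℝ ∞ fun x => b (w x) :=
  hS.smooth_b.comp hw

/-- `s ∘ w` is smooth. [folklore] -/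
theorem contDiff_s_comp (hS : IsSymmSmoothCoeff M L a b s) (hw : ContDiff ℝ ∞ w) :
    ContDiff ℝ ∞ fun x => s (w x) :=
  hS.smooth_s.comp hw

/-- `G(w)` written through the bilinear application map. [folklore] -/
theorem gfield_eq (a : Fin d → (EuclideanSpace ℝ (Fin k)) → ((EuclideanSpace ℝ (Fin k)) →L[ℝ] (EuclideanSpace ℝ (Fin k)))) (b : (EuclideanSpace ℝ (Fin k)) → (EuclideanSpace ℝ (Fin k)))
    (w : (EuclideanSpace ℝ (Fin d)) → (EuclideanSpace ℝ (Fin k))) :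
    gfield a b w = fun x => (∑ j, (ContinuousLinearMap.id ℝ ((EuclideanSpace ℝ (Fin k)) →L[ℝ] (EuclideanSpace ℝ (Fin k)))) (a j (w x))
      (cwd [j] w x)) + b (w x) := rfl

/-- `G(w)` is smooth for smooth coefficients and a smooth field. [folklore] -/
theorem contDiff_gfield (hS : IsSymmSmoothCoeff M L a b s) (hw : ContDiff ℝ ∞ w) :
    ContDiff ℝ ∞ (gfield a b w) := by
  rw [gfield_eq]
  exact (ContDiff.sum fun j _ => contDiff_bilinear_apply _ (contDiff_a_comp hS hw j)
    (contDiff_cwd hw [j])).add (contDiff_b_comp hS hw)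

/-- **Leibniz expansion of `∂_α G(w)`**:
`∂_α G(w) = Σⱼ Σ_{(p₁,p₂) ∈ splittings α} (∂_{p₁}(aⱼ∘w)) (∂_{p₂}∂ⱼw) + ∂_α(b∘w)`.
[cite: TaylorPDEIII2011, Ch. 16 §1, (1.12)] -/
theorem cwd_gfield_eq (hS : IsSymmSmoothCoeff M L a b s) (hw : ContDiff ℝ ∞ w) (α : List (Fin d)) :
    cwd α (gfield a b w) = fun x =>
      (∑ j, ((splittings α).map fun p =>
        (ContinuousLinearMap.id ℝ ((EuclideanSpace ℝ (Fin k)) →L[ℝ] (EuclideanSpace ℝ (Fin k)))) (cwd p.1 (fun y => a j (w y)) x)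
          (cwd p.2 (cwd [j] w) x)).sum) + cwd α (fun y => b (w y)) x := by
  have hT : ∀ j, ContDiff ℝ ∞ fun x =>
      (ContinuousLinearMap.id ℝ ((EuclideanSpace ℝ (Fin k)) →L[ℝ] (EuclideanSpace ℝ (Fin k)))) (a j (w x)) (cwd [j] w x) :=
    fun j => contDiff_bilinear_apply _ (contDiff_a_comp hS hw j) (contDiff_cwd hw [j])
  have hsum : ContDiff ℝ ∞ fun x =>
      ∑ j, (ContinuousLinearMap.id ℝ ((EuclideanSpace ℝ (Fin k)) →L[ℝ] (EuclideanSpace ℝ (Fin k)))) (a j (w x)) (cwd [j] w x) :=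
    ContDiff.sum fun j _ => hT j
  rw [gfield_eq, cwd_fun_add hsum (contDiff_b_comp hS hw), cwd_finset_sum Finset.univ
    (fun j _ => hT j)]
  funext x
  congr 1
  refine Finset.sum_congr rfl fun j _ => ?_
  rw [cwd_bilinear _ (contDiff_a_comp hS hw j) (contDiff_cwd hw [j]) α]

/-- **Top/lower splitting of `∂_α G(w)`**: `∂_α G(w) = Σⱼ aⱼ(w) ∂_α∂ⱼw + (lower-order part)`,
the lower-order part being the sum, over `j` and over the `2^{|α|} - 1` splittings `(p₁, p₂)` of
`α` with `p₁ ≠ []`, of `(∂_{p₁}(aⱼ∘w))(∂_{p₂}∂ⱼw)`, plus `∂_α(b∘w)`.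
[cite: Majda1984, Ch. 2 §2.1, (2.13)] -/
theorem cwd_gfield_split (hS : IsSymmSmoothCoeff M L a b s) (hw : ContDiff ℝ ∞ w)
    (α : List (Fin d)) :
    ∃ r : List (List (Fin d) × List (Fin d)), r.length + 1 = 2 ^ α.length ∧
      (∀ p ∈ r, p.1 ≠ [] ∧ p.1.length + p.2.length = α.length) ∧
      cwd α (gfield a b w) = fun x =>
        (∑ j, a j (w x) (cwd α (cwd [j] w) x)) +
        ((∑ j, (r.map fun p => (cwd p.1 (fun y => a j (w y)) x) (cwd p.2 (cwd [j] w) x)).sum) +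
          cwd α (fun y => b (w y)) x) := by
  obtain ⟨r, hr, hne⟩ := splittings_eq_cons α
  refine ⟨r, ?_, fun p hp => ⟨hne p hp, length_add_length_of_mem_splittings
    (by rw [hr]; exact List.mem_cons_of_mem _ hp)⟩, ?_⟩
  · have h := length_splittings α
    rw [hr, List.length_cons] at h
    exact h
  · rw [cwd_gfield_eq hS hw α]
    funext x
    simp only [hr, List.map_cons, List.sum_cons, ContinuousLinearMap.id_apply, cwd_nil,
      Finset.sum_add_distrib]
    abel

/-! ### The sup bound of `G(w)` -/

/-- **`‖G(w)(x)‖ ≤ (dM + L) R₀`** when `‖w‖, ‖∂ⱼw‖ ≤ R₀`. [cite: Majda1984, Ch. 2 §2.1] -/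
theorem norm_gfield_le (hS : IsSymmSmoothCoeff M L a b s) {R₀ : ℝ} (h0 : ∀ x, ‖w x‖ ≤ R₀)
    (h1 : ∀ j x, ‖cwd [j] w x‖ ≤ R₀) (x : EuclideanSpace ℝ (Fin d)) : ‖gfield a b w x‖ ≤ (d * M + L) * R₀ := by
  change ‖(∑ j, a j (w x) (cwd [j] w x)) + b (w x)‖ ≤ (d * M + L) * R₀
  calc ‖(∑ j, a j (w x) (cwd [j] w x)) + b (w x)‖
      ≤ ∑ j, ‖a j (w x) (cwd [j] w x)‖ + ‖b (w x)‖ := norm_add_le_of_le (norm_sum_le _ _) le_rfl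
    _ ≤ ∑ _j : Fin d, M * R₀ + L * R₀ :=
        add_le_add (Finset.sum_le_sum fun j _ => ((a j (w x)).le_opNorm _).trans
          (mul_le_mul (hS.norm_a j _) (h1 j x) (norm_nonneg _) hS.M_nonneg))
          ((hS.norm_b_le _).trans (mul_le_mul_of_nonneg_left (h0 x) hS.L_nonneg))
    _ = (d * M + L) * R₀ := by simp; ring

/-! ### `L²` bounds of the pieces -/

/-- **The top-order term**: `‖aⱼ(w) ∂_α∂ⱼw‖₂ ≤ M D Yₛ` when `‖∂ⱼ∂_c w‖₂ ≤ D Yₛ` for `|c| ≤ m`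
(`∂_α∂ⱼw = ∂ⱼ∂_αw` for smooth `w`). [cite: Majda1984, Ch. 2 §2.1, (2.13)] -/
theorem memLp_top_term (hS : IsSymmSmoothCoeff M L a b s) (hw : ContDiff ℝ ∞ w) {m : ℕ}
    {D Ys : ℝ}
    (hL2' : ∀ (j : Fin d) (c : List (Fin d)), c.length ≤ m →
      MemLp (cwd (j :: c) w) 2 (volume : Measure (EuclideanSpace ℝ (Fin d))) ∧ l2norm (cwd (j :: c) w) ≤ D * Ys)
    (j : Fin d) {α : List (Fin d)} (hα : α.length ≤ m) :
    MemLp (fun x => a j (w x) (cwd α (cwd [j] w) x)) 2 (volume : Measure (EuclideanSpace ℝ (Fin d))) ∧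
      l2norm (fun x => a j (w x) (cwd α (cwd [j] w) x)) ≤ M * (D * Ys) := by
  have hperm : cwd α (cwd [j] w) = cwd (j :: α) w := by
    rw [← cwd_append, cwd_perm hw List.perm_append_comm]
    rfl
  rw [hperm]
  obtain ⟨hm, hle⟩ := hL2' j α hα
  obtain ⟨hm2, hle2⟩ := memLp_clm_apply_and_l2norm_le
    ((hS.smooth_a j).continuous.comp hw.continuous) (continuous_cwd hw _) hm hS.M_nonneg
    (fun x => hS.norm_a j (w x))
  exact ⟨hm2, hle2.trans (mul_le_mul_of_nonneg_left hle hS.M_nonneg)⟩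

/-- **A lower-order term**: for a splitting `(p₁, p₂)` of `α` with `p₁ ≠ []`,
`‖(∂_{p₁}(aⱼ∘w))(∂_{p₂}∂ⱼw)‖₂ ≤ (Cₐ R₀ + Cₐ') Yₛ` — the factor with at most `q` derivatives of
`w`, or the coefficient factor with at most `m - q ≤ q` derivatives, goes in the sup norm.
[cite: TaylorPDEIII2011, Ch. 13 §3, Prop. 3.7] -/
theorem memLp_low_term (hS : IsSymmSmoothCoeff M L a b s) (hw : ContDiff ℝ ∞ w) {m q : ℕ}
    (hmq : m ≤ 2 * q) {R₀ Ys Ca Ca' : ℝ} (hR₀ : 0 ≤ R₀) (hYs : 0 ≤ Ys) (hCa : 0 ≤ Ca)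
    (hCa' : 0 ≤ Ca')
    (hsup : ∀ c : List (Fin d), c.length ≤ q → ∀ x, ‖cwd c w x‖ ≤ R₀)
    (hL2 : ∀ c : List (Fin d), c.length ≤ m →
      MemLp (cwd c w) 2 (volume : Measure (EuclideanSpace ℝ (Fin d))) ∧ l2norm (cwd c w) ≤ Ys)
    (hTa : ∀ (j : Fin d) (v : List (Fin d)), 1 ≤ v.length → v.length ≤ m →
      MemLp (cwd v (fun y => a j (w y))) 2 (volume : Measure (EuclideanSpace ℝ (Fin d))) ∧
        l2norm (cwd v (fun y => a j (w y))) ≤ Ca * Ys)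
    (hSa : ∀ (j : Fin d) (v : List (Fin d)), v.length ≤ q → ∀ x,
      ‖cwd v (fun y => a j (w y)) x‖ ≤ Ca')
    (j : Fin d) {α : List (Fin d)} (hα : α.length ≤ m) {p : List (Fin d) × List (Fin d)}
    (hp1 : p.1 ≠ []) (hlen : p.1.length + p.2.length = α.length) :
    MemLp (fun x => (cwd p.1 (fun y => a j (w y)) x) (cwd p.2 (cwd [j] w) x)) 2
        (volume : Measure (EuclideanSpace ℝ (Fin d))) ∧
      l2norm (fun x => (cwd p.1 (fun y => a j (w y)) x) (cwd p.2 (cwd [j] w) x)) ≤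
        (Ca * R₀ + Ca') * Ys := by
  have hfac : cwd p.2 (cwd [j] w) = cwd (p.2 ++ [j]) w := by rw [← cwd_append]
  have hc1 : Continuous (cwd p.1 fun y => a j (w y)) := continuous_cwd (contDiff_a_comp hS hw j) _
  have hc2 : Continuous (cwd p.2 (cwd [j] w)) := continuous_cwd (contDiff_cwd hw [j]) _
  have ha1 : 1 ≤ p.1.length :=
    Nat.one_le_iff_ne_zero.mpr fun h0 => hp1 (List.eq_nil_of_length_eq_zero h0)
  have hidn : ‖ContinuousLinearMap.id ℝ ((EuclideanSpace ℝ (Fin k)) →L[ℝ] (EuclideanSpace ℝ (Fin k)))‖ ≤ 1 := ContinuousLinearMap.norm_id_le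
  have e : (fun x => (ContinuousLinearMap.id ℝ ((EuclideanSpace ℝ (Fin k)) →L[ℝ] (EuclideanSpace ℝ (Fin k))))
      (cwd p.1 (fun y => a j (w y)) x) (cwd p.2 (cwd [j] w) x)) =
      fun x => (cwd p.1 (fun y => a j (w y)) x) (cwd p.2 (cwd [j] w) x) := rfl
  by_cases hc : p.2.length + 1 ≤ q
  · -- few derivatives on the `w`-factor: sup on it, `L²` on the coefficient factor
    obtain ⟨hm1, hle1⟩ := hTa j p.1 ha1 (by omega)
    have hsupf : ∀ x, ‖cwd p.2 (cwd [j] w) x‖ ≤ R₀ := fun x => by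
      rw [hfac]; exact hsup _ (by simp; omega) x
    obtain ⟨hm, hle⟩ := memLp_bilinear_of_bdd_right
      (ContinuousLinearMap.id ℝ ((EuclideanSpace ℝ (Fin k)) →L[ℝ] (EuclideanSpace ℝ (Fin k)))) hc1 hc2 hm1 hR₀ hsupf
    rw [e] at hm hle
    refine ⟨hm, hle.trans ?_⟩
    calc ‖ContinuousLinearMap.id ℝ ((EuclideanSpace ℝ (Fin k)) →L[ℝ] (EuclideanSpace ℝ (Fin k)))‖ * R₀ * l2norm (cwd p.1 fun y => a j (w y))
        ≤ 1 * R₀ * (Ca * Ys) :=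
          mul_le_mul (mul_le_mul_of_nonneg_right hidn hR₀) hle1 (l2norm_nonneg _) (by positivity)
      _ ≤ (Ca * R₀ + Ca') * Ys := by nlinarith [mul_nonneg hCa' hYs]
  · -- many derivatives on the `w`-factor: `|p₁| ≤ m - q ≤ q`, sup on the coefficient factor
    have ha : p.1.length ≤ q := by omega
    have hsupa : ∀ x, ‖cwd p.1 (fun y => a j (w y)) x‖ ≤ Ca' := fun x => hSa j p.1 ha x
    have hwL2 : MemLp (cwd p.2 (cwd [j] w)) 2 (volume : Measure (EuclideanSpace ℝ (Fin d))) ∧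
        l2norm (cwd p.2 (cwd [j] w)) ≤ Ys := by
      rw [hfac]; exact hL2 _ (by simp; omega)
    obtain ⟨hm, hle⟩ := memLp_bilinear_of_bdd_left
      (ContinuousLinearMap.id ℝ ((EuclideanSpace ℝ (Fin k)) →L[ℝ] (EuclideanSpace ℝ (Fin k)))) hc1 hc2 hwL2.1 hCa' hsupa
    rw [e] at hm hle
    refine ⟨hm, hle.trans ?_⟩
    calc ‖ContinuousLinearMap.id ℝ ((EuclideanSpace ℝ (Fin k)) →L[ℝ] (EuclideanSpace ℝ (Fin k)))‖ * Ca' * l2norm (cwd p.2 (cwd [j] w))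
        ≤ 1 * Ca' * Ys :=
          mul_le_mul (mul_le_mul_of_nonneg_right hidn hCa') hwL2.2 (l2norm_nonneg _) (by positivity)
      _ ≤ (Ca * R₀ + Ca') * Ys := by nlinarith [mul_nonneg (mul_nonneg hCa hR₀) hYs]

/-- **The zeroth-order coefficient term**: `‖∂_α(b∘w)‖₂ ≤ (C_b + L) Yₛ` (tame bound for
`α ≠ []`, `b(0) = 0` and `‖Db‖ ≤ L` for `α = []`). [cite: Majda1984, Ch. 2 §2.1] -/
theorem memLp_b_term (hS : IsSymmSmoothCoeff M L a b s) (hw : ContDiff ℝ ∞ w) {m : ℕ}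
    {Ys Cb : ℝ} (hYs : 0 ≤ Ys) (hCb : 0 ≤ Cb)
    (hL2 : ∀ c : List (Fin d), c.length ≤ m →
      MemLp (cwd c w) 2 (volume : Measure (EuclideanSpace ℝ (Fin d))) ∧ l2norm (cwd c w) ≤ Ys)
    (hTb : ∀ v : List (Fin d), 1 ≤ v.length → v.length ≤ m →
      MemLp (cwd v (fun y => b (w y))) 2 (volume : Measure (EuclideanSpace ℝ (Fin d))) ∧
        l2norm (cwd v (fun y => b (w y))) ≤ Cb * Ys)
    {α : List (Fin d)} (hα : α.length ≤ m) :
    MemLp (cwd α (fun y => b (w y))) 2 (volume : Measure (EuclideanSpace ℝ (Fin d))) ∧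
      l2norm (cwd α (fun y => b (w y))) ≤ (Cb + L) * Ys := by
  rcases Nat.eq_zero_or_pos α.length with h0 | hpos
  · have hnil : α = [] := List.eq_nil_of_length_eq_zero h0
    subst hnil
    obtain ⟨hm0, hle0⟩ := hL2 [] (by simp)
    rw [cwd_nil] at hm0 hle0
    obtain ⟨hm, hle⟩ := memLp_and_l2norm_le_of_le (hS.smooth_b.continuous.comp hw.continuous)
      hm0 hS.L_nonneg (fun x => hS.norm_b_le (w x))
    rw [cwd_nil]
    exact ⟨hm, hle.trans (by nlinarith [mul_le_mul_of_nonneg_left hle0 hS.L_nonneg])⟩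
  · obtain ⟨hm, hle⟩ := hTb α hpos hα
    exact ⟨hm, hle.trans (by nlinarith [mul_nonneg hS.L_nonneg hYs])⟩

/-- **The lower-order part of `∂_α G(w)` is in `L²` with**
`‖·‖₂ ≤ (d 2ᵐ (Cₐ R₀ + Cₐ') + C_b + L) Yₛ` — no factor `D`. [cite: Majda1984, Ch. 2 §2.1, (2.14)] -/
theorem memLp_low_part (hS : IsSymmSmoothCoeff M L a b s) (hw : ContDiff ℝ ∞ w) {m q : ℕ}
    (hmq : m ≤ 2 * q) {R₀ Ys Ca Ca' Cb : ℝ} (hR₀ : 0 ≤ R₀) (hYs : 0 ≤ Ys) (hCa : 0 ≤ Ca)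
    (hCa' : 0 ≤ Ca') (hCb : 0 ≤ Cb)
    (hsup : ∀ c : List (Fin d), c.length ≤ q → ∀ x, ‖cwd c w x‖ ≤ R₀)
    (hL2 : ∀ c : List (Fin d), c.length ≤ m →
      MemLp (cwd c w) 2 (volume : Measure (EuclideanSpace ℝ (Fin d))) ∧ l2norm (cwd c w) ≤ Ys)
    (hTa : ∀ (j : Fin d) (v : List (Fin d)), 1 ≤ v.length → v.length ≤ m →
      MemLp (cwd v (fun y => a j (w y))) 2 (volume : Measure (EuclideanSpace ℝ (Fin d))) ∧
        l2norm (cwd v (fun y => a j (w y))) ≤ Ca * Ys)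
    (hSa : ∀ (j : Fin d) (v : List (Fin d)), v.length ≤ q → ∀ x,
      ‖cwd v (fun y => a j (w y)) x‖ ≤ Ca')
    (hTb : ∀ v : List (Fin d), 1 ≤ v.length → v.length ≤ m →
      MemLp (cwd v (fun y => b (w y))) 2 (volume : Measure (EuclideanSpace ℝ (Fin d))) ∧
        l2norm (cwd v (fun y => b (w y))) ≤ Cb * Ys)
    {α : List (Fin d)} (hα : α.length ≤ m) {r : List (List (Fin d) × List (Fin d))}
    (hr1 : r.length + 1 = 2 ^ α.length)
    (hr : ∀ p ∈ r, p.1 ≠ [] ∧ p.1.length + p.2.length = α.length) :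
    MemLp (fun x => (∑ j, (r.map fun p => (cwd p.1 (fun y => a j (w y)) x)
        (cwd p.2 (cwd [j] w) x)).sum) + cwd α (fun y => b (w y)) x) 2 (volume : Measure (EuclideanSpace ℝ (Fin d))) ∧
      l2norm (fun x => (∑ j, (r.map fun p => (cwd p.1 (fun y => a j (w y)) x)
        (cwd p.2 (cwd [j] w) x)).sum) + cwd α (fun y => b (w y)) x) ≤
        (d * 2 ^ m * (Ca * R₀ + Ca') + (Cb + L)) * Ys := by
  -- each `j`-sum of lower terms
  have hj : ∀ j : Fin d, MemLp (fun x => (r.map fun p => (cwd p.1 (fun y => a j (w y)) x)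
      (cwd p.2 (cwd [j] w) x)).sum) 2 (volume : Measure (EuclideanSpace ℝ (Fin d))) ∧
      l2norm (fun x => (r.map fun p => (cwd p.1 (fun y => a j (w y)) x)
        (cwd p.2 (cwd [j] w) x)).sum) ≤ 2 ^ m * ((Ca * R₀ + Ca') * Ys) := by
    intro j
    obtain ⟨hm, hle⟩ := memLp_list_sum_and_l2norm_le r
      (g := fun p x => (cwd p.1 (fun y => a j (w y)) x) (cwd p.2 (cwd [j] w) x))
      (fun p hp => (memLp_low_term hS hw hmq hR₀ hYs hCa hCa' hsup hL2 hTa hSa j hα (hr p hp).1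
        (hr p hp).2).1)
      (fun p hp => (memLp_low_term hS hw hmq hR₀ hYs hCa hCa' hsup hL2 hTa hSa j hα (hr p hp).1
        (hr p hp).2).2)
    refine ⟨hm, hle.trans (mul_le_mul_of_nonneg_right ?_ (by positivity))⟩
    have h2 : (r.length : ℝ) + 1 = (2 : ℝ) ^ α.length := by exact_mod_cast hr1
    have h3 : (2 : ℝ) ^ α.length ≤ 2 ^ m := pow_le_pow_right₀ (by norm_num) hα
    linarith
  obtain ⟨hmS, hleS⟩ := memLp_finset_sum_and_l2norm_le Finset.univ (fun j _ => (hj j).1)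
    (fun j _ => (hj j).2)
  obtain ⟨hmb, hleb⟩ := memLp_b_term hS hw hYs hCb hL2 hTb hα
  refine ⟨hmS.add hmb, ?_⟩
  have hadd := l2norm_add_le hmS hmb
  have hcard : ((Finset.univ : Finset (Fin d)).card : ℝ) = d := by simp
  rw [hcard] at hleS
  calc l2norm (fun x => (∑ j, (r.map fun p => (cwd p.1 (fun y => a j (w y)) x)
        (cwd p.2 (cwd [j] w) x)).sum) + cwd α (fun y => b (w y)) x)
      ≤ l2norm (fun x => ∑ j, (r.map fun p => (cwd p.1 (fun y => a j (w y)) x)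
          (cwd p.2 (cwd [j] w) x)).sum) + l2norm (cwd α (fun y => b (w y))) := hadd
    _ ≤ d * (2 ^ m * ((Ca * R₀ + Ca') * Ys)) + (Cb + L) * Ys := add_le_add hleS hleb
    _ = (d * 2 ^ m * (Ca * R₀ + Ca') + (Cb + L)) * Ys := by ring

/-- **The top-order part is in `L²` with `‖Σⱼ aⱼ(w)∂_α∂ⱼw‖₂ ≤ d M D Yₛ`.**
[cite: Majda1984, Ch. 2 §2.1, (2.13)] -/
theorem memLp_top_part (hS : IsSymmSmoothCoeff M L a b s) (hw : ContDiff ℝ ∞ w) {m : ℕ}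
    {D Ys : ℝ}
    (hL2' : ∀ (j : Fin d) (c : List (Fin d)), c.length ≤ m →
      MemLp (cwd (j :: c) w) 2 (volume : Measure (EuclideanSpace ℝ (Fin d))) ∧ l2norm (cwd (j :: c) w) ≤ D * Ys)
    {α : List (Fin d)} (hα : α.length ≤ m) :
    MemLp (fun x => ∑ j, a j (w x) (cwd α (cwd [j] w) x)) 2 (volume : Measure (EuclideanSpace ℝ (Fin d))) ∧
      l2norm (fun x => ∑ j, a j (w x) (cwd α (cwd [j] w) x)) ≤ d * (M * (D * Ys)) := by
  obtain ⟨hm, hle⟩ := memLp_finset_sum_and_l2norm_le Finset.univ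
    (g := fun j x => a j (w x) (cwd α (cwd [j] w) x))
    (fun j _ => (memLp_top_term hS hw hL2' j hα).1) (fun j _ => (memLp_top_term hS hw hL2' j hα).2)
  have hcard : ((Finset.univ : Finset (Fin d)).card : ℝ) = d := by simp
  rw [hcard] at hle
  exact ⟨hm, hle⟩

/-- **`∂_α G(w) ∈ L²`** with `‖∂_α G(w)‖₂ ≤ (d M D + d 2ᵐ (Cₐ R₀ + Cₐ') + C_b + L) Yₛ`.
[cite: Majda1984, Ch. 2 §2.1, (2.13)–(2.14)] -/
theorem memLp_cwd_gfield (hS : IsSymmSmoothCoeff M L a b s) (hw : ContDiff ℝ ∞ w) {m q : ℕ}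
    (hmq : m ≤ 2 * q) {R₀ Ys D Ca Ca' Cb : ℝ} (hR₀ : 0 ≤ R₀) (hYs : 0 ≤ Ys)
    (hCa : 0 ≤ Ca) (hCa' : 0 ≤ Ca') (hCb : 0 ≤ Cb)
    (hsup : ∀ c : List (Fin d), c.length ≤ q → ∀ x, ‖cwd c w x‖ ≤ R₀)
    (hL2 : ∀ c : List (Fin d), c.length ≤ m →
      MemLp (cwd c w) 2 (volume : Measure (EuclideanSpace ℝ (Fin d))) ∧ l2norm (cwd c w) ≤ Ys)
    (hL2' : ∀ (j : Fin d) (c : List (Fin d)), c.length ≤ m →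
      MemLp (cwd (j :: c) w) 2 (volume : Measure (EuclideanSpace ℝ (Fin d))) ∧ l2norm (cwd (j :: c) w) ≤ D * Ys)
    (hTa : ∀ (j : Fin d) (v : List (Fin d)), 1 ≤ v.length → v.length ≤ m →
      MemLp (cwd v (fun y => a j (w y))) 2 (volume : Measure (EuclideanSpace ℝ (Fin d))) ∧
        l2norm (cwd v (fun y => a j (w y))) ≤ Ca * Ys)
    (hSa : ∀ (j : Fin d) (v : List (Fin d)), v.length ≤ q → ∀ x,
      ‖cwd v (fun y => a j (w y)) x‖ ≤ Ca')
    (hTb : ∀ v : List (Fin d), 1 ≤ v.length → v.length ≤ m →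
      MemLp (cwd v (fun y => b (w y))) 2 (volume : Measure (EuclideanSpace ℝ (Fin d))) ∧
        l2norm (cwd v (fun y => b (w y))) ≤ Cb * Ys)
    {α : List (Fin d)} (hα : α.length ≤ m) :
    MemLp (cwd α (gfield a b w)) 2 (volume : Measure (EuclideanSpace ℝ (Fin d))) ∧
      l2norm (cwd α (gfield a b w)) ≤
        (d * M * D + (d * 2 ^ m * (Ca * R₀ + Ca') + (Cb + L))) * Ys := by
  obtain ⟨r, hr1, hr, heq⟩ := cwd_gfield_split hS hw α
  obtain ⟨hmT, hleT⟩ := memLp_top_part hS hw hL2' hα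
  obtain ⟨hmL, hleL⟩ := memLp_low_part hS hw hmq hR₀ hYs hCa hCa' hCb hsup hL2 hTa hSa hTb hα hr1 hr
  rw [heq]
  refine ⟨hmT.add hmL, (l2norm_add_le hmT hmL).trans ?_⟩
  calc l2norm (fun x => ∑ j, a j (w x) (cwd α (cwd [j] w) x)) +
        l2norm (fun x => (∑ j, (r.map fun p => (cwd p.1 (fun y => a j (w y)) x)
          (cwd p.2 (cwd [j] w) x)).sum) + cwd α (fun y => b (w y)) x)
      ≤ d * (M * (D * Ys)) + (d * 2 ^ m * (Ca * R₀ + Ca') + (Cb + L)) * Ys := add_le_add hleT hleL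
    _ = (d * M * D + (d * 2 ^ m * (Ca * R₀ + Ca') + (Cb + L))) * Ys := by ring

/-! ### The symmetric operator field `Pⱼ = s(w) aⱼ(w)` of the top-order term -/

/-- `x ↦ s(w x) ∘ aⱼ(w x)` is smooth. [folklore] -/
theorem contDiff_sa_comp (hS : IsSymmSmoothCoeff M L a b s) (hw : ContDiff ℝ ∞ w) (j : Fin d) :
    ContDiff ℝ ∞ fun x => (s (w x)).comp (a j (w x)) :=
  (contDiff_s_comp hS hw).clm_comp (contDiff_a_comp hS hw j)

/-- `Pⱼ(x) = s(w x) aⱼ(w x)` is symmetric. [cite: Majda1984, Ch. 2 §2.1, (2.3)] -/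
theorem inner_sa_comp_comm (hS : IsSymmSmoothCoeff M L a b s) (j : Fin d) (x : EuclideanSpace ℝ (Fin d)) (u v : EuclideanSpace ℝ (Fin k)) :
    ⟪(s (w x)).comp (a j (w x)) u, v⟫ = ⟪u, (s (w x)).comp (a j (w x)) v⟫ := by
  simp only [ContinuousLinearMap.coe_comp, Function.comp_apply]
  exact hS.symm_sa j (w x) u v

/-- `‖Pⱼ(x)‖ ≤ K₀ M`. [folklore] -/
theorem norm_sa_comp_le (hS : IsSymmSmoothCoeff M L a b s) {K₀ : ℝ} (hK₀ : ∀ y, ‖s y‖ ≤ K₀)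
    (j : Fin d) (x : EuclideanSpace ℝ (Fin d)) : ‖(s (w x)).comp (a j (w x))‖ ≤ K₀ * M :=
  (opNorm_comp_le _ _).trans (mul_le_mul (hK₀ _) (hS.norm_a j _) (norm_nonneg _)
    ((norm_nonneg _).trans (hK₀ (w x))))

/-- **`‖∂_{j'} Pⱼ(x)‖ ≤ C_{s,1} M + K₀ C_{a,1}`** from the sup bounds of `∂_{j'}(s∘w)` and
`∂_{j'}(aⱼ∘w)` (product rule). [folklore] -/
theorem norm_fderiv_sa_comp_le (hS : IsSymmSmoothCoeff M L a b s) (hw : ContDiff ℝ ∞ w)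
    {K₀ Cs1 Ca1 : ℝ} (hK₀ : ∀ y, ‖s y‖ ≤ K₀) (j j' : Fin d)
    (hCs1 : ∀ x, ‖cwd [j'] (fun y => s (w y)) x‖ ≤ Cs1)
    (hCa1 : ∀ x, ‖cwd [j'] (fun y => a j (w y)) x‖ ≤ Ca1) (x : EuclideanSpace ℝ (Fin d)) :
    ‖fderiv ℝ (fun y => (s (w y)).comp (a j (w y))) x (bv j')‖ ≤ Cs1 * M + K₀ * Ca1 := by
  have hc : DifferentiableAt ℝ (fun y => s (w y)) x :=
    ((contDiff_s_comp hS hw).differentiable (by simp)) x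
  have hd : DifferentiableAt ℝ (fun y => a j (w y)) x :=
    ((contDiff_a_comp hS hw j).differentiable (by simp)) x
  rw [fderiv_clm_comp hc hd]
  simp only [add_apply, ContinuousLinearMap.coe_comp, Function.comp_apply,
    ContinuousLinearMap.compL_apply, ContinuousLinearMap.flip_apply]
  have h1 : ‖(s (w x)).comp (fderiv ℝ (fun y => a j (w y)) x (bv j'))‖ ≤ K₀ * Ca1 :=
    (opNorm_comp_le _ _).trans (mul_le_mul (hK₀ _) (by simpa [cwd_singleton] using hCa1 x)
      (norm_nonneg _) ((norm_nonneg _).trans (hK₀ (w x))))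
  have h2 : ‖(fderiv ℝ (fun y => s (w y)) x (bv j')).comp (a j (w x))‖ ≤ Cs1 * M :=
    (opNorm_comp_le _ _).trans (mul_le_mul (by simpa [cwd_singleton] using hCs1 x)
      (hS.norm_a j _) (norm_nonneg _) ((norm_nonneg _).trans (hCs1 x)))
  calc ‖(s (w x)).comp (fderiv ℝ (fun y => a j (w y)) x (bv j')) +
        (fderiv ℝ (fun y => s (w y)) x (bv j')).comp (a j (w x))‖
      ≤ K₀ * Ca1 + Cs1 * M := norm_add_le_of_le h1 h2
    _ = Cs1 * M + K₀ * Ca1 := by ring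

/-- **Operator-norm bound through the frame** for the derivative of a composition:
`‖D(F∘w)(x)‖ ≤ Σⱼ ‖∂ⱼ(F∘w)(x)‖ ≤ d C₁` from sup bounds of the first word derivatives. [folklore] -/
theorem norm_fderiv_comp_le_of_cwd {V : Type*} [NormedAddCommGroup V] [NormedSpace ℝ V]
    {F : (EuclideanSpace ℝ (Fin d)) → V} {C₁ : ℝ} (hC₁ : ∀ j x, ‖cwd [j] F x‖ ≤ C₁) (x : EuclideanSpace ℝ (Fin d)) :
    ‖fderiv ℝ F x‖ ≤ d * C₁ := by
  refine (opNorm_le_sum_norm_apply_bv _).trans ?_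
  calc ∑ j, ‖fderiv ℝ F x (bv j)‖ ≤ ∑ _j : Fin d, C₁ :=
        Finset.sum_le_sum fun j _ => by simpa [cwd_singleton] using hC₁ j x
    _ = d * C₁ := by simp

end Static

end Literature.Barriers.AtomisticToContinuum

end
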